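import Summits.AtomisticToContinuum.HydrodynamicLimit.Theses.AntiMazurCoboundaries
import Literature.MathematicalPhysics.KineticTheory.HardSphereEulerProofs

/-!
# A finite relative `L²(γ)`-net of the cone of cutoff shear stresses

Stub `stub_cutoffNet` (S2) of the line `cutoff-compactness-net` for the crux
`AntiMazurCoboundaries.ShearStressHalfDrude` (stmt-AtomisticToContinuum-14136): for every `A₁ > 0` and
`ε > 0` there are finitely many cutoff stresses `g_k = g_{E₁ k, E₂ k, A_k}` (`E₁ k ⊥ E₂ k`, `0 < A_k < ∞`) such
that every cutoff stress `g = g_{e₁,e₂,A}`, `g(w) = ⟪e₁,w⟫⟪e₂,w⟫(1 - smoothTransition (‖w‖²/A² - 1))` with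
`e₁ ⊥ e₂` and `A ≥ A₁`, is, up to a scalar `c`, within relative squared `L²(γ)`-distance `ε` of some `g_k`,
with `c²‖g_k‖² ≤ 2‖g‖²` (`γ = stdGaussian V3`). Pure Gaussian geometry, nothing dynamical.

Proof. Degree-2 homogeneity `g_{e₁,e₂,A} = ‖e₁‖‖e₂‖ · g_{ê₁,ê₂,A}` reduces to unit directions (`e₁ = 0` or
`e₂ = 0` gives `g = 0`, served by `c = 0`). In the compactified coordinates `(e₁, e₂, B)`, `B = A⁻¹ ∈ [0, A₁⁻¹]`
(`B = 0` is the uncut stress), the parameter set `P` (unit, orthogonal, `B ∈ [0, A₁⁻¹]`) is compact; the squared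
distance `D(p,q) = ∫ (G_p - G_q)² dγ` and the squared norm `∫ G_p² dγ` are continuous on `P × P`, `P`
(dominated convergence, bound `4‖w‖⁴`); the squared norm has a positive minimum `m` on `P` (antitone in `B`,
positive at `B = A₁⁻¹` by compact support and the witness `w⋆ = t(e₁+e₂)`); uniform continuity of `D` on the
compact `P × P` gives `δ` with `D < (min ε 1/8)·m` at distance `< δ`, and a finite `δ`-subcover by balls centred
at genuine cutoffs `B > 0` is the net. The norm comparison `‖g_k‖² ≤ (3/2)‖ĝ‖² + 3 D ≤ 2‖ĝ‖²` avoids square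
roots. Mathlib only (`continuous_of_dominated`, `IsCompact.elim_finite_subcover_image`, Heine–Cantor,
`Real.smoothTransition`) plus the tree's `integrable_norm_pow_four_stdGaussian`, `globalMaxwellian` lemmas.
-/

noncomputable section

namespace Summit.AtomisticToContinuum.HydrodynamicLimit.Theorems

namespace ShearStressHalfDrudeCutoffNet

open MeasureTheory ProbabilityTheory Filter Set
open scoped ENNReal InnerProductSpace BigOperators
open Literature.Analysis.FluidPDE Literature.MathematicalPhysics.KineticTheory

/-! ## Pointwise facts about the compactified cutoff stress

Throughout, `G e₁ e₂ B w = ⟪e₁,w⟫⟪e₂,w⟫(1 - smoothTransition (B²‖w‖² - 1))` is the cutoff stress in the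
compactified coordinates `(e₁, e₂, B)`, `B = A⁻¹` (`B = 0` is the uncut stress); the helper lemmas take the
function `G` together with this defining identity `hG` as arguments (no definition is introduced). -/

/-- Continuity of the cutoff stress in the velocity. [folklore] -/
theorem continuous_gC {G : V3 → V3 → ℝ → V3 → ℝ}
    (hG : ∀ e₁ e₂ B w, G e₁ e₂ B w = inner ℝ e₁ w * inner ℝ e₂ w * (1 - Real.smoothTransition (B ^ 2 * ‖w‖ ^ 2 - 1)))
    (e₁ e₂ : V3) (B : ℝ) : Continuous fun w : V3 => G e₁ e₂ B w := by
  simp only [hG]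
  fun_prop

/-- Continuity of the cutoff stress in the parameters `(e₁, e₂, B)`. [folklore] -/
theorem continuous_gC_param {G : V3 → V3 → ℝ → V3 → ℝ}
    (hG : ∀ e₁ e₂ B w, G e₁ e₂ B w = inner ℝ e₁ w * inner ℝ e₂ w * (1 - Real.smoothTransition (B ^ 2 * ‖w‖ ^ 2 - 1)))
    (w : V3) : Continuous fun p : V3 × V3 × ℝ => G p.1 p.2.1 p.2.2 w := by
  simp only [hG]
  fun_prop

/-- `|G| ≤ ‖w‖²` for sub-unit directions (the cutoff factor lies in `[0, 1]`). [folklore] -/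
theorem abs_gC_le {G : V3 → V3 → ℝ → V3 → ℝ}
    (hG : ∀ e₁ e₂ B w, G e₁ e₂ B w = inner ℝ e₁ w * inner ℝ e₂ w * (1 - Real.smoothTransition (B ^ 2 * ‖w‖ ^ 2 - 1)))
    {e₁ e₂ : V3} (h₁ : ‖e₁‖ ≤ 1) (h₂ : ‖e₂‖ ≤ 1) (B : ℝ) (w : V3) : |G e₁ e₂ B w| ≤ ‖w‖ ^ 2 := by
  have h0 : 0 ≤ Real.smoothTransition (B ^ 2 * ‖w‖ ^ 2 - 1) := Real.smoothTransition.nonneg _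
  have h1 : Real.smoothTransition (B ^ 2 * ‖w‖ ^ 2 - 1) ≤ 1 := Real.smoothTransition.le_one _
  have hi1 : |inner ℝ e₁ w| ≤ ‖w‖ :=
    (abs_real_inner_le_norm e₁ w).trans (mul_le_of_le_one_left (norm_nonneg w) h₁)
  have hi2 : |inner ℝ e₂ w| ≤ ‖w‖ :=
    (abs_real_inner_le_norm e₂ w).trans (mul_le_of_le_one_left (norm_nonneg w) h₂)
  have hcut : |1 - Real.smoothTransition (B ^ 2 * ‖w‖ ^ 2 - 1)| ≤ 1 := by
    rw [abs_le]; constructor <;> linarith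
  rw [hG, abs_mul, abs_mul]
  calc |inner ℝ e₁ w| * |inner ℝ e₂ w| * |1 - Real.smoothTransition (B ^ 2 * ‖w‖ ^ 2 - 1)|
      ≤ ‖w‖ * ‖w‖ * 1 := by gcongr
    _ = ‖w‖ ^ 2 := by ring

/-- The cutoff stress vanishes where `B²‖w‖² ≥ 2`. [folklore] -/
theorem gC_eq_zero_of_le {G : V3 → V3 → ℝ → V3 → ℝ}
    (hG : ∀ e₁ e₂ B w, G e₁ e₂ B w = inner ℝ e₁ w * inner ℝ e₂ w * (1 - Real.smoothTransition (B ^ 2 * ‖w‖ ^ 2 - 1)))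
    (e₁ e₂ : V3) {B : ℝ} {w : V3} (hw : 2 ≤ B ^ 2 * ‖w‖ ^ 2) : G e₁ e₂ B w = 0 := by
  have h1 : (1 : ℝ) ≤ B ^ 2 * ‖w‖ ^ 2 - 1 := by linarith
  rw [hG, Real.smoothTransition.one_of_one_le h1, sub_self, mul_zero]

/-- The squared cutoff stress is antitone in the inverse cutoff `B ≥ 0` (`smoothTransition` is monotone).
[folklore] -/
theorem gC_sq_anti {G : V3 → V3 → ℝ → V3 → ℝ}
    (hG : ∀ e₁ e₂ B w, G e₁ e₂ B w = inner ℝ e₁ w * inner ℝ e₂ w * (1 - Real.smoothTransition (B ^ 2 * ‖w‖ ^ 2 - 1)))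
    (e₁ e₂ : V3) {B B' : ℝ} (hB : 0 ≤ B) (hBB' : B ≤ B') (w : V3) :
    G e₁ e₂ B' w ^ 2 ≤ G e₁ e₂ B w ^ 2 := by
  have hsq : B ^ 2 ≤ B' ^ 2 := pow_le_pow_left₀ hB hBB' 2
  have harg : B ^ 2 * ‖w‖ ^ 2 - 1 ≤ B' ^ 2 * ‖w‖ ^ 2 - 1 :=
    sub_le_sub_right (mul_le_mul_of_nonneg_right hsq (sq_nonneg _)) 1
  have h0 : 0 ≤ 1 - Real.smoothTransition (B' ^ 2 * ‖w‖ ^ 2 - 1) :=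
    sub_nonneg.2 (Real.smoothTransition.le_one _)
  have hle : 1 - Real.smoothTransition (B' ^ 2 * ‖w‖ ^ 2 - 1) ≤
      1 - Real.smoothTransition (B ^ 2 * ‖w‖ ^ 2 - 1) :=
    sub_le_sub_left (Real.smoothTransition.monotone harg) 1
  have key := mul_le_mul_of_nonneg_left (pow_le_pow_left₀ h0 hle 2)
    (sq_nonneg (inner ℝ e₁ w * inner ℝ e₂ w))
  rw [hG, hG]
  simpa only [mul_pow] using key

/-- `∫ G² dγ > 0` for unit orthogonal directions and a genuine cutoff `B > 0`: the squared stress times the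
Maxwellian is continuous, compactly supported, nonnegative, and nonzero at `w⋆ = t(e₁+e₂)`, `t = B⁻¹/2`.
[folklore] -/
theorem integral_gC_sq_pos {G : V3 → V3 → ℝ → V3 → ℝ}
    (hG : ∀ e₁ e₂ B w, G e₁ e₂ B w = inner ℝ e₁ w * inner ℝ e₂ w * (1 - Real.smoothTransition (B ^ 2 * ‖w‖ ^ 2 - 1)))
    {e₁ e₂ : V3} (h₁ : ‖e₁‖ = 1) (h₂ : ‖e₂‖ = 1) (he : inner ℝ e₁ e₂ = 0)
    {B : ℝ} (hB : 0 < B) : 0 < ∫ w, G e₁ e₂ B w ^ 2 ∂stdGaussian V3 := by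
  rw [integral_stdGaussian_eq_integral_mul_globalMaxwellian]
  have hc : Continuous fun v : V3 => globalMaxwellian v * G e₁ e₂ B v ^ 2 :=
    continuous_globalMaxwellian.mul ((continuous_gC hG e₁ e₂ B).pow 2)
  have hs : HasCompactSupport fun v : V3 => globalMaxwellian v * G e₁ e₂ B v ^ 2 := by
    refine HasCompactSupport.intro (isCompact_closedBall (0 : V3) (2 / B)) fun w hw => ?_
    rw [Metric.mem_closedBall, dist_zero_right, not_le, div_lt_iff₀ hB] at hw
    have h2 : 2 ≤ B ^ 2 * ‖w‖ ^ 2 := by nlinarith [sq_nonneg (‖w‖ * B - 2)]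
    simp [gC_eq_zero_of_le hG e₁ e₂ h2]
  have hnn : 0 ≤ fun v : V3 => globalMaxwellian v * G e₁ e₂ B v ^ 2 := fun v =>
    mul_nonneg (globalMaxwellian_pos v).le (sq_nonneg _)
  obtain ⟨t, htpos, hBt⟩ : ∃ t : ℝ, 0 < t ∧ B ^ 2 * (2 * t ^ 2) - 1 = -(1 / 2) :=
    ⟨B⁻¹ / 2, by positivity, by field_simp; ring⟩
  have he' : inner ℝ e₂ e₁ = 0 := by rw [real_inner_comm]; exact he
  have hn : ‖t • (e₁ + e₂)‖ ^ 2 = 2 * t ^ 2 := by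
    rw [norm_smul, mul_pow, Real.norm_eq_abs, sq_abs, norm_add_sq_real, h₁, h₂, he]; ring
  have hcut : Real.smoothTransition (B ^ 2 * ‖t • (e₁ + e₂)‖ ^ 2 - 1) = 0 := by
    refine Real.smoothTransition.zero_of_nonpos ?_
    rw [hn, hBt]; norm_num
  have hval : G e₁ e₂ B (t • (e₁ + e₂)) = t ^ 2 := by
    rw [hG, hcut, real_inner_smul_right, real_inner_smul_right, inner_add_right, inner_add_right,
      real_inner_self_eq_norm_sq, real_inner_self_eq_norm_sq, h₁, h₂, he, he']
    ring
  have hx : (fun v : V3 => globalMaxwellian v * G e₁ e₂ B v ^ 2) (t • (e₁ + e₂)) ≠ 0 := by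
    show globalMaxwellian (t • (e₁ + e₂)) * G e₁ e₂ B (t • (e₁ + e₂)) ^ 2 ≠ 0
    rw [hval]
    exact mul_ne_zero (globalMaxwellian_pos _).ne' (by positivity)
  exact hc.integral_pos_of_hasCompactSupport_nonneg_nonzero hs hnn hx

/-! ## Parametric Gaussian integrals of squares -/

/-- A continuous function dominated by `C‖w‖²` is square integrable under `γ` (`‖w‖⁴` is, by Fernique).
[folklore] -/
theorem integrable_sq_of_abs_le (Φ : V3 → ℝ) (C : ℝ) (hc : Continuous Φ)
    (hbd : ∀ w, |Φ w| ≤ C * ‖w‖ ^ 2) : Integrable (fun w => Φ w ^ 2) (stdGaussian V3) := by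
  refine ((integrable_norm_pow_four_stdGaussian (ι := Fin 3)).const_mul (C ^ 2)).mono'
    (hc.pow 2).aestronglyMeasurable (ae_of_all _ fun w => ?_)
  rw [Real.norm_of_nonneg (sq_nonneg _), ← sq_abs]
  calc |Φ w| ^ 2 ≤ (C * ‖w‖ ^ 2) ^ 2 := pow_le_pow_left₀ (abs_nonneg _) (hbd w) 2
    _ = C ^ 2 * ‖w‖ ^ 4 := by ring

/-- Dominated convergence: `y ↦ ∫ (Φ y w)² dγ(w)` is continuous for a jointly-in-`y`, separately-in-`w`
continuous family dominated by `C‖w‖²`. [folklore] -/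
theorem continuous_integral_sq {Y : Type*} [TopologicalSpace Y] [FirstCountableTopology Y]
    (Φ : Y → V3 → ℝ) (C : ℝ) (hmeas : ∀ y, Continuous (Φ y)) (hcont : ∀ w, Continuous fun y => Φ y w)
    (hbd : ∀ y w, |Φ y w| ≤ C * ‖w‖ ^ 2) :
    Continuous fun y => ∫ w, Φ y w ^ 2 ∂stdGaussian V3 := by
  refine continuous_of_dominated (bound := fun w => C ^ 2 * ‖w‖ ^ 4)
    (fun y => ((hmeas y).pow 2).aestronglyMeasurable) (fun y => ae_of_all _ fun w => ?_)
    ((integrable_norm_pow_four_stdGaussian (ι := Fin 3)).const_mul (C ^ 2))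
    (ae_of_all _ fun w => (hcont w).pow 2)
  rw [Real.norm_of_nonneg (sq_nonneg _), ← sq_abs]
  calc |Φ y w| ^ 2 ≤ (C * ‖w‖ ^ 2) ^ 2 := pow_le_pow_left₀ (abs_nonneg _) (hbd y w) 2
    _ = C ^ 2 * ‖w‖ ^ 4 := by ring

/-- Elementary rescaling identity behind the degree-2 homogeneity `g_{e₁,e₂,A} = ‖e₁‖‖e₂‖·g_{ê₁,ê₂,A}`.
[folklore] -/
theorem mul_mul_rescale (a b x y S : ℝ) (ha : a ≠ 0) (hb : b ≠ 0) :
    x * y * S = a * b * (a⁻¹ * x * (b⁻¹ * y) * S) := by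
  calc x * y * S = (a * a⁻¹) * (b * b⁻¹) * (x * y * S) := by
        rw [mul_inv_cancel₀ ha, mul_inv_cancel₀ hb, one_mul, one_mul]
    _ = a * b * (a⁻¹ * x * (b⁻¹ * y) * S) := by ring

/-! ## The stub -/

/-- **S2 — FINITE NET OF THE CUTOFF CONE.** For every `A₁ > 0` and `ε > 0` there are finitely many cutoff
stresses `g_k = g_{E₁ k, E₂ k, A_k}` (`E₁ k ⊥ E₂ k`, `0 < A_k`) such that every cutoff stress `g = g_{e₁,e₂,A}`
with `e₁ ⊥ e₂` and `A ≥ A₁` is, up to a scalar `c`, within relative squared `L²(γ)`-distance `ε` of some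
`g_k`, with `c²‖g_k‖²_γ ≤ 2‖g‖²_γ`. -/
theorem stub_cutoffNet :
    ∀ A₁ : ℝ, 0 < A₁ → ∀ ε : ℝ, 0 < ε →
    ∃ (n : ℕ) (E₁ E₂ : Fin n → V3) (Ac : Fin n → ℝ),
      (∀ k, inner ℝ (E₁ k) (E₂ k) = 0 ∧ 0 < Ac k) ∧
      ∀ (e₁ e₂ : V3), inner ℝ e₁ e₂ = 0 → ∀ A : ℝ, A₁ ≤ A →
      ∀ g : V3 → ℝ, (g = fun w => inner ℝ e₁ w * inner ℝ e₂ w * (1 - Real.smoothTransition (‖w‖ ^ 2 / A ^ 2 - 1))) →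
        ∃ (k : Fin n) (c : ℝ),
          ∫ v, (g v - c * (inner ℝ (E₁ k) v * inner ℝ (E₂ k) v *
              (1 - Real.smoothTransition (‖v‖ ^ 2 / (Ac k) ^ 2 - 1)))) ^ 2 ∂stdGaussian V3 ≤
            ε * ∫ v, g v ^ 2 ∂stdGaussian V3 ∧
          c ^ 2 * ∫ v, (inner ℝ (E₁ k) v * inner ℝ (E₂ k) v *
              (1 - Real.smoothTransition (‖v‖ ^ 2 / (Ac k) ^ 2 - 1))) ^ 2 ∂stdGaussian V3 ≤
            2 * ∫ v, g v ^ 2 ∂stdGaussian V3 := by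
  intro A₁ hA₁ ε hε
  -- the cutoff stress in compactified coordinates `(e₁, e₂, B)`, `B = A⁻¹`, as an opaque local function
  obtain ⟨G, hG⟩ : ∃ G : V3 → V3 → ℝ → V3 → ℝ, ∀ e₁ e₂ B w,
      G e₁ e₂ B w = inner ℝ e₁ w * inner ℝ e₂ w * (1 - Real.smoothTransition (B ^ 2 * ‖w‖ ^ 2 - 1)) :=
    ⟨fun e₁ e₂ B w => _, fun _ _ _ _ => rfl⟩
  obtain ⟨ε', hε'pos, hε'le, hε'le8⟩ : ∃ ε' : ℝ, 0 < ε' ∧ ε' ≤ ε ∧ ε' ≤ 1 / 8 :=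
    ⟨min ε (1 / 8), lt_min hε (by norm_num), min_le_left _ _, min_le_right _ _⟩
  have hB₁pos : 0 < A₁⁻¹ := inv_pos.2 hA₁
  -- the compact parameter set: unit orthogonal directions, inverse cutoffs `B ∈ [0, A₁⁻¹]`
  set P : Set (V3 × V3 × ℝ) :=
    (Metric.sphere (0 : V3) 1 ×ˢ (Metric.sphere (0 : V3) 1 ×ˢ Icc 0 A₁⁻¹)) ∩
      {p | inner ℝ p.1 p.2.1 = 0} with hP
  have hmemP : ∀ p : V3 × V3 × ℝ, p ∈ P ↔
      ‖p.1‖ = 1 ∧ ‖p.2.1‖ = 1 ∧ 0 ≤ p.2.2 ∧ p.2.2 ≤ A₁⁻¹ ∧ inner ℝ p.1 p.2.1 = 0 := fun p => by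
    simp only [hP, mem_inter_iff, mem_prod, mem_sphere_zero_iff_norm, mem_Icc, mem_setOf_eq, and_assoc]
  have hPc : IsCompact P :=
    ((isCompact_sphere 0 1).prod ((isCompact_sphere 0 1).prod isCompact_Icc)).inter_right
      (isClosed_eq (by fun_prop) continuous_const)
  haveI : CompactSpace P := isCompact_iff_compactSpace.1 hPc
  have hp₀ : ((EuclideanSpace.single 0 1 : V3), (EuclideanSpace.single 1 1 : V3), (0 : ℝ)) ∈ P := by
    rw [hmemP]
    refine ⟨by simp, by simp, le_rfl, hB₁pos.le, ?_⟩
    simp [EuclideanSpace.inner_single_left]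
  -- pointwise bounds on `P`
  have hbd1 : ∀ (p : P) (w : V3), |G p.1.1 p.1.2.1 p.1.2.2 w| ≤ 1 * ‖w‖ ^ 2 := fun p w => by
    obtain ⟨h1, h2, -, -, -⟩ := (hmemP p.1).1 p.2
    rw [one_mul]; exact abs_gC_le hG h1.le h2.le _ _
  have hbd2 : ∀ (x : P × P) (w : V3),
      |G x.1.1.1 x.1.1.2.1 x.1.1.2.2 w - G x.2.1.1 x.2.1.2.1 x.2.1.2.2 w| ≤ 2 * ‖w‖ ^ 2 :=
    fun x w => (abs_sub _ _).trans (by linarith [hbd1 x.1 w, hbd1 x.2 w])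
  -- continuity of the squared norm on `P` and of the squared distance on `P × P`
  have hNc : Continuous fun p : P => ∫ w, G p.1.1 p.1.2.1 p.1.2.2 w ^ 2 ∂stdGaussian V3 :=
    continuous_integral_sq (fun (p : P) w => G p.1.1 p.1.2.1 p.1.2.2 w) 1
      (fun p => continuous_gC hG _ _ _) (fun w => (continuous_gC_param hG w).comp continuous_subtype_val) hbd1
  have hDc : Continuous fun x : P × P => ∫ w, (G x.1.1.1 x.1.1.2.1 x.1.1.2.2 w -
      G x.2.1.1 x.2.1.2.1 x.2.1.2.2 w) ^ 2 ∂stdGaussian V3 :=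
    continuous_integral_sq (fun (x : P × P) w => G x.1.1.1 x.1.1.2.1 x.1.1.2.2 w -
        G x.2.1.1 x.2.1.2.1 x.2.1.2.2 w) 2
      (fun x => (continuous_gC hG _ _ _).sub (continuous_gC hG _ _ _))
      (fun w => ((continuous_gC_param hG w).comp (continuous_subtype_val.comp continuous_fst)).sub
        ((continuous_gC_param hG w).comp (continuous_subtype_val.comp continuous_snd))) hbd2
  -- the positive minimum of the squared norm on `P`
  obtain ⟨m, hmpos, hm⟩ : ∃ m : ℝ, 0 < m ∧
      ∀ p : P, m ≤ ∫ w, G p.1.1 p.1.2.1 p.1.2.2 w ^ 2 ∂stdGaussian V3 := by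
    obtain ⟨pm, -, hpm⟩ := isCompact_univ.exists_isMinOn
      (⟨⟨_, hp₀⟩, mem_univ _⟩ : (univ : Set P).Nonempty) hNc.continuousOn
    refine ⟨_, ?_, fun p => isMinOn_univ_iff.1 hpm p⟩
    obtain ⟨h1, h2, hB0, hBle, hinner⟩ := (hmemP pm.1).1 pm.2
    refine lt_of_lt_of_le (integral_gC_sq_pos hG h1 h2 hinner hB₁pos) (integral_mono ?_ ?_ fun w => ?_)
    · exact integrable_sq_of_abs_le _ 1 (continuous_gC hG _ _ _) fun w => by
        rw [one_mul]; exact abs_gC_le hG h1.le h2.le _ _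
    · exact integrable_sq_of_abs_le _ 1 (continuous_gC hG _ _ _) fun w => by
        rw [one_mul]; exact abs_gC_le hG h1.le h2.le _ _
    · exact gC_sq_anti hG _ _ hB0 hBle w
  -- uniform continuity of the squared distance on the compact `P × P`
  obtain ⟨δ, hδ, hUC⟩ := Metric.uniformContinuous_iff.1
    (CompactSpace.uniformContinuous_of_continuous hDc) (ε' * m) (by positivity)
  -- a finite cover of `P` by `δ`-balls centred at genuine cutoffs `B > 0`
  obtain ⟨β, hβpos, hβδ, hβB⟩ : ∃ β : ℝ, 0 < β ∧ β < δ ∧ β ≤ A₁⁻¹ :=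
    ⟨min (δ / 2) A₁⁻¹, lt_min (half_pos hδ) hB₁pos, (min_le_left _ _).trans_lt (half_lt_self hδ),
      min_le_right _ _⟩
  have hcov : (univ : Set P) ⊆ ⋃ q ∈ {q : P | 0 < q.1.2.2}, Metric.ball q δ := by
    intro p _
    obtain ⟨hp1, hp2, hpB0, hpB1, hpi⟩ := (hmemP p.1).1 p.2
    have hq : (p.1.1, p.1.2.1, max p.1.2.2 β) ∈ P :=
      (hmemP _).2 ⟨hp1, hp2, hpB0.trans (le_max_left _ _), max_le hpB1 hβB, hpi⟩
    rw [mem_iUnion₂]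
    refine ⟨⟨_, hq⟩, lt_max_of_lt_right hβpos, ?_⟩
    rw [Metric.mem_ball, Subtype.dist_eq, Prod.dist_eq, Prod.dist_eq]
    refine max_lt (by simp [hδ]) (max_lt (by simp [hδ]) ?_)
    show dist p.1.2.2 (max p.1.2.2 β) < δ
    rw [Real.dist_eq, abs_sub_comm, abs_of_nonneg (sub_nonneg.2 (le_max_left _ _))]
    have : max p.1.2.2 β ≤ p.1.2.2 + β :=
      max_le (le_add_of_nonneg_right hβpos.le) (le_add_of_nonneg_left hpB0)
    linarith
  obtain ⟨b', hb'sub, hb'fin, hb'cov⟩ :=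
    isCompact_univ.elim_finite_subcover_image (fun q _ => Metric.isOpen_ball) hcov
  obtain ⟨n, f, hf⟩ := hb'fin.fin_embedding
  have hfk : ∀ k, 0 < (f k).1.2.2 := fun k => hb'sub (hf ▸ mem_range_self k)
  have hnet : ∀ p : P, ∃ k, dist (f k) p < δ := fun p => by
    obtain ⟨q, hq, hpq⟩ := mem_iUnion₂.1 (hb'cov (mem_univ p))
    rw [← hf] at hq
    obtain ⟨k, rfl⟩ := hq
    exact ⟨k, by rwa [Metric.mem_ball, dist_comm] at hpq⟩
  -- the net
  refine ⟨n, fun k => (f k).1.1, fun k => (f k).1.2.1, fun k => ((f k).1.2.2)⁻¹, fun k => ?_, ?_⟩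
  · obtain ⟨-, -, -, -, hinner⟩ := (hmemP (f k).1).1 (f k).2
    exact ⟨hinner, inv_pos.2 (hfk k)⟩
  intro e₁ e₂ he A hA g hg
  subst hg
  -- the net functions in compactified coordinates
  have hnetfun : ∀ (k : Fin n) (v : V3), inner ℝ (f k).1.1 v * inner ℝ (f k).1.2.1 v *
      (1 - Real.smoothTransition (‖v‖ ^ 2 / ((f k).1.2.2)⁻¹ ^ 2 - 1)) =
      G (f k).1.1 (f k).1.2.1 (f k).1.2.2 v := fun k v => by
    rw [hG, inv_pow, div_inv_eq_mul, mul_comm (‖v‖ ^ 2)]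
  obtain ⟨k₀, -⟩ := hnet ⟨_, hp₀⟩
  by_cases h0 : e₁ = 0 ∨ e₂ = 0
  · -- degenerate query: `g = 0`, served by any net point with `c = 0`
    have hz : ∀ v : V3, inner ℝ e₁ v * inner ℝ e₂ v = 0 := fun v => by
      rcases h0 with h | h <;> simp [h]
    exact ⟨k₀, 0, by simp [hz], by simp [hz]⟩
  obtain ⟨h1, h2⟩ := not_or.1 h0
  have hn1 : ‖e₁‖ ≠ 0 := norm_ne_zero_iff.2 h1
  have hn2 : ‖e₂‖ ≠ 0 := norm_ne_zero_iff.2 h2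
  have hApos : 0 < A := hA₁.trans_le hA
  -- the normalised parameter point `p = (ê₁, ê₂, A⁻¹) ∈ P`
  have hpP : (‖e₁‖⁻¹ • e₁, ‖e₂‖⁻¹ • e₂, A⁻¹) ∈ P := by
    rw [hmemP]
    refine ⟨?_, ?_, (inv_pos.2 hApos).le, inv_anti₀ hA₁ hA, ?_⟩
    · rw [norm_smul, norm_inv, norm_norm, inv_mul_cancel₀ hn1]
    · rw [norm_smul, norm_inv, norm_norm, inv_mul_cancel₀ hn2]
    · rw [real_inner_smul_left, real_inner_smul_right, he, mul_zero, mul_zero]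
  obtain ⟨k, hk⟩ := hnet ⟨_, hpP⟩
  -- degree-2 homogeneity: `g = ‖e₁‖‖e₂‖ · G(p)`
  have hgp : ∀ v : V3, inner ℝ e₁ v * inner ℝ e₂ v * (1 - Real.smoothTransition (‖v‖ ^ 2 / A ^ 2 - 1)) =
      ‖e₁‖ * ‖e₂‖ * G (‖e₁‖⁻¹ • e₁) (‖e₂‖⁻¹ • e₂) A⁻¹ v := fun v => by
    have hAv : ‖v‖ ^ 2 / A ^ 2 = A⁻¹ ^ 2 * ‖v‖ ^ 2 := by rw [inv_pow, div_eq_inv_mul]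
    rw [hG, hAv, real_inner_smul_left, real_inner_smul_left]
    exact mul_mul_rescale _ _ _ _ _ hn1 hn2
  -- integrability of the squares involved
  have hbu : ∀ w, |G (‖e₁‖⁻¹ • e₁) (‖e₂‖⁻¹ • e₂) A⁻¹ w| ≤ 1 * ‖w‖ ^ 2 := hbd1 ⟨_, hpP⟩
  have hbr : ∀ w, |G (f k).1.1 (f k).1.2.1 (f k).1.2.2 w| ≤ 1 * ‖w‖ ^ 2 := hbd1 (f k)
  have hbru : ∀ w, |G (f k).1.1 (f k).1.2.1 (f k).1.2.2 w - G (‖e₁‖⁻¹ • e₁) (‖e₂‖⁻¹ • e₂) A⁻¹ w| ≤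
      2 * ‖w‖ ^ 2 := hbd2 (f k, ⟨_, hpP⟩)
  have hu_int := integrable_sq_of_abs_le (fun w => G (‖e₁‖⁻¹ • e₁) (‖e₂‖⁻¹ • e₂) A⁻¹ w) 1
    (continuous_gC hG _ _ _) hbu
  have hr_int := integrable_sq_of_abs_le (fun w => G (f k).1.1 (f k).1.2.1 (f k).1.2.2 w) 1
    (continuous_gC hG _ _ _) hbr
  have hru_int := integrable_sq_of_abs_le
    (fun w => G (f k).1.1 (f k).1.2.1 (f k).1.2.2 w - G (‖e₁‖⁻¹ • e₁) (‖e₂‖⁻¹ • e₂) A⁻¹ w) 2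
    ((continuous_gC hG _ _ _).sub (continuous_gC hG _ _ _)) hbru
  -- the two values of the squared distance at `(p, q_k)` and `(q_k, p)` are `< ε' m`
  have habs : ∀ {x y : ℝ}, dist x y < ε' * m → y = 0 → x < ε' * m := fun h hy => by
    rw [Real.dist_eq, hy, sub_zero] at h; exact (abs_lt.1 h).2
  have hDpp : ∫ w, (G (‖e₁‖⁻¹ • e₁) (‖e₂‖⁻¹ • e₂) A⁻¹ w - G (‖e₁‖⁻¹ • e₁) (‖e₂‖⁻¹ • e₂) A⁻¹ w) ^ 2
      ∂stdGaussian V3 = 0 := by simp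
  have hd1 : dist ((⟨_, hpP⟩ : P), f k) ((⟨_, hpP⟩ : P), (⟨_, hpP⟩ : P)) < δ := by
    rw [Prod.dist_eq]; exact max_lt (by simp [hδ]) hk
  have hd2 : dist (f k, (⟨_, hpP⟩ : P)) ((⟨_, hpP⟩ : P), (⟨_, hpP⟩ : P)) < δ := by
    rw [Prod.dist_eq]; exact max_lt hk (by simp [hδ])
  have hD1 : ∫ w, (G (‖e₁‖⁻¹ • e₁) (‖e₂‖⁻¹ • e₂) A⁻¹ w - G (f k).1.1 (f k).1.2.1 (f k).1.2.2 w) ^ 2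
      ∂stdGaussian V3 < ε' * m := habs (hUC hd1) hDpp
  have hD2 : ∫ w, (G (f k).1.1 (f k).1.2.1 (f k).1.2.2 w - G (‖e₁‖⁻¹ • e₁) (‖e₂‖⁻¹ • e₂) A⁻¹ w) ^ 2
      ∂stdGaussian V3 < ε' * m := habs (hUC hd2) hDpp
  have hIu : m ≤ ∫ w, G (‖e₁‖⁻¹ • e₁) (‖e₂‖⁻¹ • e₂) A⁻¹ w ^ 2 ∂stdGaussian V3 := hm ⟨_, hpP⟩
  have hIu0 : 0 ≤ ∫ w, G (‖e₁‖⁻¹ • e₁) (‖e₂‖⁻¹ • e₂) A⁻¹ w ^ 2 ∂stdGaussian V3 :=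
    integral_nonneg fun w => sq_nonneg _
  have hεm : ε' * m ≤ ε' * ∫ w, G (‖e₁‖⁻¹ • e₁) (‖e₂‖⁻¹ • e₂) A⁻¹ w ^ 2 ∂stdGaussian V3 :=
    mul_le_mul_of_nonneg_left hIu hε'pos.le
  -- norm comparison without square roots: `‖g_k‖² ≤ (3/2)‖ĝ‖² + 3 D ≤ 2‖ĝ‖²`
  have hIr : ∫ w, G (f k).1.1 (f k).1.2.1 (f k).1.2.2 w ^ 2 ∂stdGaussian V3 ≤
      2 * ∫ w, G (‖e₁‖⁻¹ • e₁) (‖e₂‖⁻¹ • e₂) A⁻¹ w ^ 2 ∂stdGaussian V3 := by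
    have hpt : ∀ w, G (f k).1.1 (f k).1.2.1 (f k).1.2.2 w ^ 2 ≤
        (3 / 2) * G (‖e₁‖⁻¹ • e₁) (‖e₂‖⁻¹ • e₂) A⁻¹ w ^ 2 +
          3 * (G (f k).1.1 (f k).1.2.1 (f k).1.2.2 w - G (‖e₁‖⁻¹ • e₁) (‖e₂‖⁻¹ • e₂) A⁻¹ w) ^ 2 :=
      fun w => by
        nlinarith [sq_nonneg (3 * G (‖e₁‖⁻¹ • e₁) (‖e₂‖⁻¹ • e₂) A⁻¹ w -
          2 * G (f k).1.1 (f k).1.2.1 (f k).1.2.2 w)]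
    calc ∫ w, G (f k).1.1 (f k).1.2.1 (f k).1.2.2 w ^ 2 ∂stdGaussian V3
        ≤ ∫ w, ((3 / 2) * G (‖e₁‖⁻¹ • e₁) (‖e₂‖⁻¹ • e₂) A⁻¹ w ^ 2 +
            3 * (G (f k).1.1 (f k).1.2.1 (f k).1.2.2 w - G (‖e₁‖⁻¹ • e₁) (‖e₂‖⁻¹ • e₂) A⁻¹ w) ^ 2)
            ∂stdGaussian V3 :=
          integral_mono hr_int ((hu_int.const_mul _).add (hru_int.const_mul _)) hpt
      _ = (3 / 2) * ∫ w, G (‖e₁‖⁻¹ • e₁) (‖e₂‖⁻¹ • e₂) A⁻¹ w ^ 2 ∂stdGaussian V3 +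
            3 * ∫ w, (G (f k).1.1 (f k).1.2.1 (f k).1.2.2 w - G (‖e₁‖⁻¹ • e₁) (‖e₂‖⁻¹ • e₂) A⁻¹ w) ^ 2
              ∂stdGaussian V3 := by
          rw [integral_add (hu_int.const_mul _) (hru_int.const_mul _), integral_const_mul,
            integral_const_mul]
      _ ≤ 2 * ∫ w, G (‖e₁‖⁻¹ • e₁) (‖e₂‖⁻¹ • e₂) A⁻¹ w ^ 2 ∂stdGaussian V3 := by
          have h8 := mul_le_mul_of_nonneg_right hε'le8 hIu0
          linarith
  -- pulling the scalar `c = ‖e₁‖‖e₂‖` out of the two integrals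
  have e1 : ∫ v, (‖e₁‖ * ‖e₂‖ * G (‖e₁‖⁻¹ • e₁) (‖e₂‖⁻¹ • e₂) A⁻¹ v -
      ‖e₁‖ * ‖e₂‖ * G (f k).1.1 (f k).1.2.1 (f k).1.2.2 v) ^ 2 ∂stdGaussian V3 =
      (‖e₁‖ * ‖e₂‖) ^ 2 * ∫ v, (G (‖e₁‖⁻¹ • e₁) (‖e₂‖⁻¹ • e₂) A⁻¹ v -
        G (f k).1.1 (f k).1.2.1 (f k).1.2.2 v) ^ 2 ∂stdGaussian V3 := by
    rw [← integral_const_mul]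
    congr 1 with v
    ring
  have e2 : ∫ v, (‖e₁‖ * ‖e₂‖ * G (‖e₁‖⁻¹ • e₁) (‖e₂‖⁻¹ • e₂) A⁻¹ v) ^ 2 ∂stdGaussian V3 =
      (‖e₁‖ * ‖e₂‖) ^ 2 * ∫ v, G (‖e₁‖⁻¹ • e₁) (‖e₂‖⁻¹ • e₂) A⁻¹ v ^ 2 ∂stdGaussian V3 := by
    rw [← integral_const_mul]
    congr 1 with v
    ring
  refine ⟨k, ‖e₁‖ * ‖e₂‖, ?_, ?_⟩
  · simp only [hgp, hnetfun]
    rw [e1, e2]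
    have hle : ∫ v, (G (‖e₁‖⁻¹ • e₁) (‖e₂‖⁻¹ • e₂) A⁻¹ v - G (f k).1.1 (f k).1.2.1 (f k).1.2.2 v) ^ 2
        ∂stdGaussian V3 ≤ ε * ∫ v, G (‖e₁‖⁻¹ • e₁) (‖e₂‖⁻¹ • e₂) A⁻¹ v ^ 2 ∂stdGaussian V3 :=
      hD1.le.trans (hεm.trans (mul_le_mul_of_nonneg_right hε'le hIu0))
    calc (‖e₁‖ * ‖e₂‖) ^ 2 * ∫ v, (G (‖e₁‖⁻¹ • e₁) (‖e₂‖⁻¹ • e₂) A⁻¹ v -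
          G (f k).1.1 (f k).1.2.1 (f k).1.2.2 v) ^ 2 ∂stdGaussian V3
        ≤ (‖e₁‖ * ‖e₂‖) ^ 2 * (ε * ∫ v, G (‖e₁‖⁻¹ • e₁) (‖e₂‖⁻¹ • e₂) A⁻¹ v ^ 2 ∂stdGaussian V3) :=
          mul_le_mul_of_nonneg_left hle (sq_nonneg _)
      _ = ε * ((‖e₁‖ * ‖e₂‖) ^ 2 * ∫ v, G (‖e₁‖⁻¹ • e₁) (‖e₂‖⁻¹ • e₂) A⁻¹ v ^ 2 ∂stdGaussian V3) := by
          ring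
  · simp only [hgp, hnetfun]
    rw [e2]
    calc (‖e₁‖ * ‖e₂‖) ^ 2 * ∫ v, G (f k).1.1 (f k).1.2.1 (f k).1.2.2 v ^ 2 ∂stdGaussian V3
        ≤ (‖e₁‖ * ‖e₂‖) ^ 2 * (2 * ∫ v, G (‖e₁‖⁻¹ • e₁) (‖e₂‖⁻¹ • e₂) A⁻¹ v ^ 2 ∂stdGaussian V3) :=
          mul_le_mul_of_nonneg_left hIr (sq_nonneg _)
      _ = 2 * ((‖e₁‖ * ‖e₂‖) ^ 2 * ∫ v, G (‖e₁‖⁻¹ • e₁) (‖e₂‖⁻¹ • e₂) A⁻¹ v ^ 2 ∂stdGaussian V3) := by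
          ring

end ShearStressHalfDrudeCutoffNet

end Summit.AtomisticToContinuum.HydrodynamicLimit.Theorems
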